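import Summits.BirchSwinnertonDyer.Rank1Residual.X12.O11.RamifiedStrictDescentAtThreeRegimeTInputs
import Summits.BirchSwinnertonDyer.Rank1Residual.X12.O11.RamifiedEllipticUnitMechanismZpThreeV
import HarnessLib

/-!
# O11 at `p = 3`, companion VII-c — regime T of route `PrintCFram` (item stmt-BirchSwinnertonDyer-20699):
# (R-ctrl)₃ᵀ♯ holds OUTRIGHT, (R-tors)₃ᵀ follows from GZK, `BSD(W, 3)` at ANY rank-one `3`-frame from
# the ONE residual (R-EU)₃ᵀ + local finiteness + four named facts, and (R-EU)₃ᵀ ⟹ (R-EU)₃ᵛ ⟹ (R-EU)₃: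
# ONE torsion-allowing law serves the whole `@3` crux (cell `bsd-print-cfram`, D-0131 (2), typer `ty2`
# gen 3; PLAN v5 ask (δ)(iv); sequel of `RamifiedStrictDescentAtThreeRegimeTInputs.lean`)

HONEST FRAMING (cell `bsd-print-cfram`, HOME `run/shared/lean/pub/bsd-print-cfram/`): THEOREMS ONLY
(no definition, no named fact, no axiom, no `sorry`); nothing about BSD is booked; regimes N, V, T and
the leaf stay OPEN; beyond-print theorem: NO.

* §3 `ramifiedCMDefectControlAtThreeT_holds` — (R-ctrl)₃ᵀ♯ is a THEOREM for every elliptic `W/ℚ`: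
  companion VII's count `#Sel^γ · d₀ = #Sel_str(W)·#Sel_str(W')·d(T₀)` (WITHOUT (A𝔭)₃) + Greenberg's
  Lemma 4.2 Euler characteristic (k7r-c4 `eulerIdentity_of_hasCharValuationAt`).
  `ramifiedCMStrictTorsionAtThreeT_of_GZK` — (R-tors)₃ᵀ ⟸ GZK (`Sel_𝔭(K)` finite by GZK + (D♮)₃, then
  `Sel^γ` finite by companion VII, then Greenberg's criterion + Lemma 4.2).
  `bsdp_three_of_ramifiedCMEllipticUnitIndexAtThreeT` — the consumer with both discharged;
  `bsdp_three_of_indexLawAtThreeT_of_isFrameThree` — `BSDp W 3` at ANY analytic-rank-one `3`-frame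
  from (R-EU)₃ᵀ + the class-level local finiteness statement + four facts, NO (A𝔭)₃, NO away binder,
  NO frame data (`T₀ = Σ(N⁺)`; tower, generator and mod-torsion levels built for the given frame).
* §4 `ramifiedCMEllipticUnitIndexAtThreeV_of_indexAtThreeT` — **(R-EU)₃ᵀ ⟹ (R-EU)₃ᵛ**: under (A𝔭)₃
  `d₀ = 1` (`globalControlDefectAtThree_eq_one_of_noThreeTorsion`: `res` injective), `ker r_𝔭 = 0` is
  finite, and a pure `3`-divisibility level is a mod-torsion level
  (`modTorsionLevel_of_level_of_noPTorsion`); with companion VI-V's (R-EU)₃ᵛ ⟹ (R-EU)₃ this makes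
  (R-EU)₃ᵀ the ONE residual law of all three regimes. Likewise (R-tors)₃ᵀ ⟹ (R-tors)₃ᵛ.

References: [GreenbergLNM1716] §1 Thm. 1.2, §3 Lemmas 3.1–3.4, §4 Lemma 4.2, Prop. 4.13; [Kolyvagin1990]
Thm. A; [Castella2018] Def. 2.2, Thm. 2.3 (shape); [Miller2011LMS] Def. 1.1; [Cassels1965ArithmeticVIII];
[GrossZagier1986] Thm. I.(7.3); [SilvermanAEC2009] VII.5 Prop. 5.1(a), Prop. VII.6.3; [KuriharaPollack2007]
§1.5; tree: companions V–VII-b, X11b `AnticyclotomicControlNPlus`, `AnticyclotomicRestrictionInjective`,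
`Additive/StrictSelmerIndexLocal`; HOME/PLAN.md v5 (δ).
-/

noncomputable section

open scoped Classical

open WeierstrassCurve NumberField IsDedekindDomain Field PowerSeries
  Literature.NumberTheory.EllipticCurves
  Literature.NumberTheory.EllipticCurves.GreenbergSelmer
  Literature.NumberTheory.EllipticCurves.Rank1Residual
  Literature.NumberTheory.GaloisRepresentations
  Summit.BirchSwinnertonDyer.Rank1Residual
  Summit.BirchSwinnertonDyer.Rank1Residual.Additive
  Summit.BirchSwinnertonDyer.Rank1Residual.X11b
  Summit.BirchSwinnertonDyer.Rank1Residual.X11b.AcSelmer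
  Summit.BirchSwinnertonDyer.BirchSwinnertonDyer.Theorems

namespace Summit.BirchSwinnertonDyer.Rank1Residual.X12.O11

variable (W : WeierstrassCurve ℚ) [W.IsElliptic] [W.IsGloballyMinimal]

/-! ## §3 (R-ctrl)₃ᵀ♯ holds outright; (R-tors)₃ᵀ from GZK; the consumer from (R-EU)₃ᵀ alone -/

section Discharge

omit [W.IsGloballyMinimal] in
/-- **(R-ctrl)₃ᵀ♯ is a THEOREM: `RamifiedCMDefectControlAtThreeT W` for every elliptic `W/ℚ`.** From
`ord₃ f(0) = n₀`: `Sel^γ` is finite and `n₀ + log₃ #X[T] = log₃ #Sel^γ` (Greenberg's Lemma 4.2, k7r-c4's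
`eulerIdentity_of_hasCharValuationAt`); companion VII's torsion-allowing count
`#Sel^γ · d₀ = #Sel_str(W)·#Sel_str(W')·d(T₀)` (`natCard_invariants_mul_globalDefect_eq_mul_defect_of_isFrameThree`
+ (D♮)₃, under the displayed finiteness of `ker r_𝔭` and of `Sel_𝔭(K)`; it also yields `d₀` finite,
hence non-zero); `log₃` of a non-zero product is additive. No (A𝔭)₃, no class hypothesis, no named fact.
[cite: GreenbergLNM1716, §3 Lemmas 3.1–3.4 and §4 Lemma 4.2] -/
theorem ramifiedCMDefectControlAtThreeT_holds : RamifiedCMDefectControlAtThreeT W := by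
  intro K _ _ 𝔭 W' _ _ C hF _ κ hκ γ hγ hfin𝔭 T₀ hT₀ hv hbase n₀ hchar _
  haveI : (W.baseChange K).IsElliptic := by rw [baseChange]; infer_instance
  haveI := hbase
  -- Euler characteristic: `Sel^γ` finite and `n₀ + log₃ #X[T] = log₃ #Sel^γ`
  obtain ⟨hfinγ, -, heuler⟩ :=
    RamifiedSevenEllipticUnits.eulerIdentity_of_hasCharValuationAt (W.baseChange K) 3 κ 𝔭 γ hchar
  -- the torsion-allowing count of companion VII (gives finiteness of `ker(res)` too)
  obtain ⟨-, hfinker, hcount, -⟩ := natCard_invariants_mul_globalDefect_eq_mul_defect_of_isFrameThree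
    hF κ hκ γ hfin𝔭 T₀ hT₀ hv
  rw [natCard_selmerAcBase_frameThree_eq_mul W hF] at hcount
  -- all factors are non-zero (finite non-empty groups)
  haveI hfinγ' : Finite (IwasawaDual.endInvariants
      (Castella2018.AcSelmer.conjSelmerAc (W.baseChange K) 3 κ 𝔭 ∅ γ - 1)) := hfinγ
  have hγne : Nat.card (IwasawaDual.endInvariants
      (Castella2018.AcSelmer.conjSelmerAc (W.baseChange K) 3 κ 𝔭 ∅ γ - 1)) ≠ 0 := Nat.card_pos.ne'
  have hd₀ne : globalControlDefectAtThree W K κ ≠ 0 := by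
    rw [globalControlDefectAtThree_def]
    haveI := hfinker
    exact Nat.card_pos.ne'
  have hne : Nat.card ↥(strictSelmerPInfty W 3) * Nat.card ↥(strictSelmerPInfty W' 3) *
      controlDefectAtThree W K 𝔭 κ T₀ ≠ 0 := by
    rw [← hcount]
    exact mul_ne_zero hγne hd₀ne
  have hne12 : Nat.card ↥(strictSelmerPInfty W 3) * Nat.card ↥(strictSelmerPInfty W' 3) ≠ 0 :=
    left_ne_zero_of_mul hne
  have hB : padicValNat 3 (Nat.card (IwasawaDual.endInvariants
      (Castella2018.AcSelmer.conjSelmerAc (W.baseChange K) 3 κ 𝔭 ∅ γ - 1))) +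
      padicValNat 3 (globalControlDefectAtThree W K κ) =
      padicValNat 3 (Nat.card ↥(strictSelmerPInfty W 3)) +
        padicValNat 3 (Nat.card ↥(strictSelmerPInfty W' 3)) +
        padicValNat 3 (controlDefectAtThree W K 𝔭 κ T₀) := by
    rw [← padicValNat.mul hγne hd₀ne, hcount, padicValNat.mul hne12 (right_ne_zero_of_mul hne),
      padicValNat.mul (left_ne_zero_of_mul hne12) (right_ne_zero_of_mul hne12)]
  have key : ((n₀ : ℤ) + padicValNat 3 (Nat.card {x : Castella2018.AcSelmer.XAc
      (W.baseChange K) 3 κ 𝔭 ∅ γ // (PowerSeries.X : IwasawaAlgebra 3) • x = 0})) +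
      padicValNat 3 (globalControlDefectAtThree W K κ) =
      (padicValNat 3 (Nat.card ↥(strictSelmerPInfty W 3)) : ℤ) +
        padicValNat 3 (Nat.card ↥(strictSelmerPInfty W' 3)) +
        padicValNat 3 (controlDefectAtThree W K 𝔭 κ T₀) := by
    have h := heuler
    have h' : n₀ + padicValNat 3 (Nat.card {x : Castella2018.AcSelmer.XAc
        (W.baseChange K) 3 κ 𝔭 ∅ γ // (PowerSeries.X : IwasawaAlgebra 3) • x = 0}) +
        padicValNat 3 (globalControlDefectAtThree W K κ) =
        padicValNat 3 (Nat.card ↥(strictSelmerPInfty W 3)) +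
          padicValNat 3 (Nat.card ↥(strictSelmerPInfty W' 3)) +
          padicValNat 3 (controlDefectAtThree W K 𝔭 κ T₀) := by
      rw [h, hB]
    exact_mod_cast h'
  exact key

omit [W.IsGloballyMinimal] in
/-- **(R-tors)₃ᵀ from Gross–Zagier–Kolyvagin alone** (`hGZK`): at an analytic-rank-one `3`-frame both
`ℚ`-side strict `3^∞`-Selmer groups are finite under GZK (`W' ∼ W`), hence `Sel_𝔭(K, W[3^∞])` by
(D♮)₃, hence `Sel^γ` by companion VII's torsion-allowing count (displayed finiteness of `ker r_𝔭`,
NO (A𝔭)₃), and Greenberg's criterion + Lemma 4.2 give the shape. [cite: Kolyvagin1990, Thm. A]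
[cite: GreenbergLNM1716, §1 Thm. 1.2 and §4 Lemma 4.2] -/
theorem ramifiedCMStrictTorsionAtThreeT_of_GZK (hGZK : rank_eq_analyticRank_of_analyticRank_le_one) :
    RamifiedCMStrictTorsionAtThreeT W := by
  intro K _ _ 𝔭 W' _ _ C hF hr κ hκ γ _ hfin𝔭 T₀ hT₀ hv
  haveI : (W.baseChange K).IsElliptic := by rw [baseChange]; infer_instance
  have hr' : W'.analyticRank = 1 := by
    rw [← analyticRank_eq_of_isIsogenous' (isIsogenous_of_isFrameThree hF), hr]
  have hfinW : Finite ↥(strictSelmerPInfty W 3) :=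
    RamifiedSevenEllipticUnits.finite_strictSelmerPInfty_of_GZK hGZK W 3 hr
  have hfinW' : Finite ↥(strictSelmerPInfty W' 3) :=
    RamifiedSevenEllipticUnits.finite_strictSelmerPInfty_of_GZK hGZK W' 3 hr'
  haveI hbase : Finite (selmerAcBase (W.baseChange K) 3 𝔭 ∅) := by
    refine Nat.finite_of_card_ne_zero ?_
    rw [natCard_selmerAcBase_frameThree_eq_mul W hF]
    exact mul_ne_zero Nat.card_pos.ne' Nat.card_pos.ne'
  have hfin := (natCard_invariants_mul_globalDefect_eq_mul_defect_of_isFrameThree hF κ hκ γ hfin𝔭 T₀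
    hT₀ hv).1
  obtain ⟨n₀, hn₀, hfinT⟩ :=
    RamifiedSevenEllipticUnits.exists_hasCharValuationAt_and_finite_of_finite
      (W.baseChange K) 3 κ 𝔭 γ hfin
  exact ⟨⟨n₀, hn₀⟩, hfinT⟩

variable {W}
variable {K : Type} [Field K] [NumberField K] {𝔭 : HeightOneSpectrum (𝓞 K)}
  {W' : WeierstrassCurve ℚ} [W'.IsElliptic] [W'.IsGloballyMinimal] {C : VariableChange ℚ}
  {κ : ZpExtension K 3} {P : W.toAffine.Point} {n : ℕ} {P' : W'.toAffine.Point} {n' : ℕ}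

/-- **`BSD(W, 3)` at any `3`-frame from (R-EU)₃ᵀ alone + four named facts**: `bsdp_three_of_halvesT`
with (R-tors)₃ᵀ ⟸ GZK and (R-ctrl)₃ᵀ♯ a theorem. Displayed: frame, `r_an(W) = 1`, anticyclotomic `κ`
with generator, generators with mod-torsion levels, finiteness of `ker r_𝔭`, a finite `T₀` of places
`v ∤ 3` with (Av)₃ off `T₀`, and modularity / Gross–Zagier I.(7.3) / GZK / Cassels. CONDITIONAL on
(R-EU)₃ᵀ; nothing asserted about it. [cite: Miller2011LMS, §1 and Def. 1.1] [cite: Cassels1965ArithmeticVIII]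
[cite: GrossZagier1986, Thm. I.(7.3)] -/
theorem bsdp_three_of_ramifiedCMEllipticUnitIndexAtThreeT (hmod : hasEntireLFunction_rat)
    (hGZ : GrossZagier1986_thm_I_7_3) (hGZK : rank_eq_analyticRank_of_analyticRank_le_one)
    (hCassels : bsdRHS_eq_of_isIsogenous) (h3 : RamifiedCMEllipticUnitIndexAtThreeT W)
    (hF : IsFrameThree W K 𝔭 W' C) (hr : W.analyticRank = 1)
    (hκ : κ.IsAnticyclotomic) (γ : absoluteGaloisGroup K) [Fact (κ.IsTopGenerator γ)]
    (hP : ¬ IsOfFinAddOrder P)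
    (hgen : ∀ R : W.toAffine.Point, ∃ (k : ℤ) (T : W.toAffine.Point),
      IsOfFinAddOrder T ∧ R = k • P + T)
    (hdiv : ∃ Q T : (W.baseChange ℚ_[3]).toAffine.Point, IsOfFinAddOrder T ∧
      (3 : ℕ) ^ n • Q = W.toPadicPoint 3 P + T)
    (hndiv : ∀ Q T : (W.baseChange ℚ_[3]).toAffine.Point, IsOfFinAddOrder T →
      (3 : ℕ) ^ (n + 1) • Q ≠ W.toPadicPoint 3 P + T)
    (hP' : ¬ IsOfFinAddOrder P')
    (hgen' : ∀ R : W'.toAffine.Point, ∃ (k : ℤ) (T : W'.toAffine.Point),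
      IsOfFinAddOrder T ∧ R = k • P' + T)
    (hdiv' : ∃ Q T : (W'.baseChange ℚ_[3]).toAffine.Point, IsOfFinAddOrder T ∧
      (3 : ℕ) ^ n' • Q = W'.toPadicPoint 3 P' + T)
    (hndiv' : ∀ Q T : (W'.baseChange ℚ_[3]).toAffine.Point, IsOfFinAddOrder T →
      (3 : ℕ) ^ (n' + 1) • Q ≠ W'.toPadicPoint 3 P' + T)
    (hfin𝔭 : Finite (localKer κ.kerSubgroup ((W.baseChange K).geomPrimaryTorsion 3) 𝔭))
    (T₀ : Finset (HeightOneSpectrum (𝓞 K))) (hT₀ : ∀ v ∈ T₀, ((3 : ℕ) : 𝓞 K) ∉ v.asIdeal)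
    (hv : ∀ v : HeightOneSpectrum (𝓞 K), v ∉ T₀ → ((3 : ℕ) : 𝓞 K) ∉ v.asIdeal →
      v.asIdeal.ramificationIdx (𝓞 ℚ) = 1 → v.asIdeal.inertiaDeg (𝓞 ℚ) = 1 →
      (W.baseChange K).HasGoodReductionAt v ∨
        ∀ R : ((W.baseChange K).baseChange (v.adicCompletion K)).toAffine.Point,
          (3 : ℕ) • R = 0 → R = 0) :
    BSDp W 3 :=
  bsdp_three_of_halvesT hmod hGZ hGZK hCassels (ramifiedCMStrictTorsionAtThreeT_of_GZK W hGZK)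
    (ramifiedCMDefectControlAtThreeT_holds W) h3 hF hr hκ γ hP hgen hdiv hndiv hP' hgen' hdiv' hndiv'
    hfin𝔭 T₀ hT₀ hv

/-- **`BSD(W, 3)` at ANY analytic-rank-one `3`-frame — regimes N ∪ V ∪ T, NO (A𝔭)₃, NO away binder,
NO frame data — from (R-EU)₃ᵀ + the class-level local finiteness statement + four named facts.** Take
`T₀ = Σ(N⁺)` (`nPlus_admissible_three`) and build the frame data for the GIVEN frame (anticyclotomic
`ℤ₃`-tower of `K` with generator; Mordell–Weil generators of `W`, `W'` with their mod-torsion levels,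
`exists_generator_with_modTorsion_level`; rank one by GZK / isogeny invariance); the local finiteness
is demanded for every anticyclotomic tower of the frame (`hfin`, p3's discharge). CONDITIONAL on
(R-EU)₃ᵀ and `hfin`; nothing booked. [cite: Miller2011LMS, §1 and Def. 1.1] [cite: Darmon2004, Thm. 3.22 and §3.9]
[cite: Washington1997, Thm. 13.4] [cite: SilvermanAEC2009, Prop. VII.6.3 and Thm. VIII.6.7] -/
theorem bsdp_three_of_indexLawAtThreeT_of_isFrameThree (hmod : hasEntireLFunction_rat)
    (hGZ : GrossZagier1986_thm_I_7_3) (hGZK : rank_eq_analyticRank_of_analyticRank_le_one)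
    (hCassels : bsdRHS_eq_of_isIsogenous) (hF : IsFrameThree W K 𝔭 W' C) (hr : W.analyticRank = 1)
    (hfin : ∀ κ : ZpExtension K 3, κ.IsAnticyclotomic →
      Finite (localKer κ.kerSubgroup ((W.baseChange K).geomPrimaryTorsion 3) 𝔭))
    (h3 : RamifiedCMEllipticUnitIndexAtThreeT W) : BSDp W 3 := by
  have hK : IsImaginaryQuadratic K := hF.2.2.1
  have hiso : IsIsogenous W W' := isIsogenous_of_isFrameThree hF
  obtain ⟨κ, hκ⟩ := ZpExtension.exists_isAnticyclotomic_holds (K := K) (p := 3) hK.1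
    (fun w => hK.2.isComplex w)
  obtain ⟨γ, hγ⟩ := κ.exists_isTopGenerator
  haveI : Fact (κ.IsTopGenerator γ) := ⟨hγ⟩
  have hrank : W.mordellWeilRank = 1 := by rw [(hGZK W hr.le).1, hr]
  have hr' : W'.analyticRank = 1 := by rw [← analyticRank_eq_of_isIsogenous' hiso, hr]
  have hrank' : W'.mordellWeilRank = 1 := by rw [(hGZK W' hr'.le).1, hr']
  obtain ⟨P, n, hP, hgen, hdiv, hndiv⟩ := exists_generator_with_modTorsion_level W 3 hrank
  obtain ⟨P', n', hP', hgen', hdiv', hndiv'⟩ := exists_generator_with_modTorsion_level W' 3 hrank'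
  obtain ⟨hT₀, hv⟩ := nPlus_admissible_three (W := W) (K := K) hK.1
  exact bsdp_three_of_ramifiedCMEllipticUnitIndexAtThreeT hmod hGZ hGZK hCassels h3 hF hr hκ γ hP hgen
    hdiv hndiv hP' hgen' hdiv' hndiv' (hfin κ hκ) _ hT₀ hv

end Discharge

/-! ## §4 (R-EU)₃ᵀ ⟹ (R-EU)₃ᵛ: one law for the three regimes -/

section Specialise

variable {W}

section GlobalDefectOne

variable {K : Type} [Field K] [NumberField K] {𝔭 : HeightOneSpectrum (𝓞 K)}

omit [W.IsGloballyMinimal] in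
/-- **`d₀ = 1` when `W_K(K_𝔭)[3] = 0`**: then `res : H¹(K, W[3^∞]) → H¹(K_∞, W[3^∞])` is injective
(Greenberg's Lemma 3.1 with `B = 0`: `fixedPoints_kerSubgroup_eq_bot_of_noPTorsion`,
`resSubgroup_kerSubgroup_injective_of_fixedPoints_eq_bot`, `resOfLe_top_injective_of`), so its kernel is
trivial. On regimes N ∪ V the displayed global defect is therefore `1` by proof.
[cite: GreenbergLNM1716, §3 Lemma 3.1] -/
theorem globalControlDefectAtThree_eq_one_of_noThreeTorsion (κ : ZpExtension K 3)
    (γ : absoluteGaloisGroup K) [hγ : Fact (κ.IsTopGenerator γ)]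
    (h𝔭 : ∀ R : ((W.baseChange K).baseChange (𝔭.adicCompletion K)).toAffine.Point,
      (3 : ℕ) • R = 0 → R = 0) :
    globalControlDefectAtThree W K κ = 1 := by
  haveI : (W.baseChange K).IsElliptic := by rw [baseChange]; infer_instance
  have hinj : Function.Injective
      (ResKernel.resSubgroup κ.kerSubgroup ((W.baseChange K).geomPrimaryTorsion 3)) :=
    resSubgroup_kerSubgroup_injective_of_fixedPoints_eq_bot (W.baseChange K) 3 κ hγ.out
      (RamifiedSevenEllipticUnits.fixedPoints_kerSubgroup_eq_bot_of_noPTorsion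
        (W.baseChange K) 3 κ 𝔭 h𝔭)
  have hinj' := resOfLe_top_injective_of (M := (W.baseChange K).geomPrimaryTorsion 3) hinj
  rw [globalControlDefectAtThree_def,
    (AddMonoidHom.ker_eq_bot_iff _).mpr (by exact hinj'), AddSubgroup.card_bot]

end GlobalDefectOne

/-- A pure `p`-divisibility level is a mod-torsion level when the group has no `p`-torsion: if
`p^n • Q = X` and no `Q'` has `p^(n+1) • Q' = X`, then `X` has exact level `n` modulo torsion
(a torsion `T` with `p^(n+1) • Q' = X + T` is `p^(n+1)`-divisible — Bezout, b2b's
`exists_eq_pow_nsmul_of_isOfFinAddOrder` — contradicting the exact pure level). [folklore] -/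
theorem modTorsionLevel_of_level_of_noPTorsion {G : Type*} [AddCommGroup G] (p : ℕ) [Fact p.Prime]
    (hnoTors : ∀ X : G, p • X = 0 → X = 0) {X : G} {n : ℕ}
    (hdiv : ∃ Q : G, p ^ n • Q = X) (hndiv : ∀ Q : G, p ^ (n + 1) • Q ≠ X) :
    (∃ Q T : G, IsOfFinAddOrder T ∧ p ^ n • Q = X + T) ∧
      ∀ Q T : G, IsOfFinAddOrder T → p ^ (n + 1) • Q ≠ X + T := by
  refine ⟨?_, fun Q T hT hQ => ?_⟩
  · obtain ⟨Q, hQ⟩ := hdiv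
    exact ⟨Q, 0, isOfFinAddOrder_iff_nsmul_eq_zero.mpr ⟨1, Nat.one_pos, smul_zero _⟩,
      by rw [hQ, add_zero]⟩
  · obtain ⟨T', hT'⟩ := StrictSha.exists_eq_pow_nsmul_of_isOfFinAddOrder p hnoTors hT (n + 1)
    apply hndiv (Q - T')
    rw [smul_sub, hQ, hT', add_sub_cancel_right]

omit [W.IsGloballyMinimal] in
/-- **(R-EU)₃ᵀ ⟹ (R-EU)₃ᵛ** (PROVED): at a frame carrying the (A𝔭)₃ binders of (R-EU)₃ᵛ, `W_K(K_𝔭)[3] = 0`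
(companion II), so `ker r_𝔭 = 0` is finite, `d₀ = 1` (`globalControlDefectAtThree_eq_one_of_noThreeTorsion`),
and the pure `3`-divisibility levels `n`, `n'` of (R-EU)₃ᵛ are mod-torsion levels
(`modTorsionLevel_of_level_of_noPTorsion`, using `W(ℚ₃)[3] = 0`, `W'(ℚ₃)[3] = 0`); the torsion-allowing
law then reads `n₀ + log₃ #X[T] + 0 = n + n' + ord₃ q + ord₃ q' + log₃ d(T₀)`. With companion VI-V's
`ramifiedCMEllipticUnitIndexAtThree_of_indexAtThreeV`, (R-EU)₃ᵀ ⟹ (R-EU)₃ᵛ ⟹ (R-EU)₃: ONE residual law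
for the regimes T ⊃ V ⊃ N of the `@3` crux. [cite: GreenbergLNM1716, §3 Lemmas 3.1 and 3.3–3.4]
[cite: PerrinRiou1993AIF, §3.3.4–3.3.5] -/
theorem ramifiedCMEllipticUnitIndexAtThreeV_of_indexAtThreeT
    (h3 : RamifiedCMEllipticUnitIndexAtThreeT W) : RamifiedCMEllipticUnitIndexAtThreeV W := by
  intro K _ _ 𝔭 W' _ _ C hF hr κ hκ γ _ P n P' n' hP hgen htors hdiv hndiv hP' hgen' htors' hdiv' hndiv'
    T₀ hT₀ hv q q' hq hq' n₀ hn₀ hfin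
  haveI : (W.baseChange K).IsElliptic := by rw [baseChange]; infer_instance
  have h𝔭 := noThreeTorsion_adicCompletion_of_isFrameThree W hF htors htors'
  have hfin𝔭 : Finite (localKer κ.kerSubgroup ((W.baseChange K).geomPrimaryTorsion 3) 𝔭) := by
    rw [AcSelmer.localKer_eq_bot_of_noPTorsion (W.baseChange K) 3 κ 𝔭 h𝔭]; infer_instance
  obtain ⟨hdivT, hndivT⟩ := modTorsionLevel_of_level_of_noPTorsion 3 htors hdiv hndiv
  obtain ⟨hdivT', hndivT'⟩ := modTorsionLevel_of_level_of_noPTorsion 3 htors' hdiv' hndiv'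
  have e := h3 K 𝔭 W' C hF hr κ hκ γ P n P' n' hP hgen hdivT hndivT hP' hgen' hdivT' hndivT' hfin𝔭
    T₀ hT₀ hv q q' hq hq' n₀ hn₀ hfin
  rw [globalControlDefectAtThree_eq_one_of_noThreeTorsion κ γ h𝔭, padicValNat_one_right, Nat.cast_zero,
    add_zero] at e
  exact e

omit [W.IsGloballyMinimal] in
/-- **(R-EU)₃ᵀ ⟹ (R-EU)₃** (PROVED): through (R-EU)₃ᵛ (`ramifiedCMEllipticUnitIndexAtThree_of_indexAtThreeV`,
companion VI-V). [cite: PerrinRiou1993AIF, §3.3.4–3.3.5] -/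
theorem ramifiedCMEllipticUnitIndexAtThree_of_indexAtThreeT
    (h3 : RamifiedCMEllipticUnitIndexAtThreeT W) : RamifiedCMEllipticUnitIndexAtThree W :=
  ramifiedCMEllipticUnitIndexAtThree_of_indexAtThreeV
    (ramifiedCMEllipticUnitIndexAtThreeV_of_indexAtThreeT h3)

omit [W.IsGloballyMinimal] in
/-- **(R-tors)₃ᵀ ⟹ (R-tors)₃ᵛ** (PROVED): under (A𝔭)₃ the local kernel at `𝔭` is trivial, hence finite.
[cite: GreenbergLNM1716, §3 Lemmas 3.3–3.4 (the local kernels)] -/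
theorem ramifiedCMStrictTorsionAtThreeV_of_strictTorsionAtThreeT
    (ht : RamifiedCMStrictTorsionAtThreeT W) : RamifiedCMStrictTorsionAtThreeV W := by
  intro K _ _ 𝔭 W' _ _ C hF hr κ hκ γ _ htors htors' T₀ hT₀ hv
  haveI : (W.baseChange K).IsElliptic := by rw [baseChange]; infer_instance
  have h𝔭 := noThreeTorsion_adicCompletion_of_isFrameThree W hF htors htors'
  have hfin𝔭 : Finite (localKer κ.kerSubgroup ((W.baseChange K).geomPrimaryTorsion 3) 𝔭) := by
    rw [AcSelmer.localKer_eq_bot_of_noPTorsion (W.baseChange K) 3 κ 𝔭 h𝔭]; infer_instance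
  exact ht K 𝔭 W' C hF hr κ hκ γ hfin𝔭 T₀ hT₀ hv

end Specialise

end Summit.BirchSwinnertonDyer.Rank1Residual.X12.O11

end
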